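import Summits.BirchSwinnertonDyer.BirchSwinnertonDyer.Theorems.PrintCf2SplitBadTwoNormAtVbarTotallyRamified
import Summits.BirchSwinnertonDyer.BirchSwinnertonDyer.Theorems.PrintCf2SplitBadTwoKummerUNonSplitValuation
import Summits.BirchSwinnertonDyer.BirchSwinnertonDyer.Theorems.PrintCf2SplitBadTwoSplitPrimeLineSaturationAnyP
import Summits.BirchSwinnertonDyer.BirchSwinnertonDyer.Theorems.EisensteinPrimesAnomalousUnramifiedKernelFinite
import Summits.BirchSwinnertonDyer.Rank1Residual.X11b.CoinvariantsDescent
import Literature.NumberTheory.NumberFields.UnramifiedCompositum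
import Mathlib.NumberTheory.RamificationInertia.Unramified
import HarnessLib

/-!
# Crux `PrintCf2.SplitBadTwoRankOneOfFacts` (stmt-BirchSwinnertonDyer-20368), skeleton v13.5, R2 brick **B5-U FILE 3: THE LOSSY `v̄` READING ON LAYERS
# WHERE `v̄` IS UNRAMIFIED AND UNDECOMPOSED** (the `v`-LINE `K^{(v)}_m` of M-LINE-PIN's inner-regularity socket (R), LEAD g14 07:39:56Z):
# clause (iii) at `v̄` ⟹ `n ∣ [F:K] · ord_{w′}(b)`, and the `Γ_K`-currency inputs on the `v`-line

Cell `bsd-print-cf2`, EXTRA WIDTH seat `bsd-line-cf2-p1-w3` g14 (prover-bsd-line-cf2-p1-w3-g14-0); `--supports stmt-BirchSwinnertonDyer-20368`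
(helper, Theses-free). HONEST FRAMING: nothing here closes the crux or a registered stub; BSD is not proved by any of this; no summit
statement is proved by this seat. No definition, no named fact, no `sorry`. UNCONDITIONAL. Sequel of FILE 1 (p706643) and FILE 2 (p707091).

WHY. On the `v̄`-LINE `K*_m` the place `v̄` is totally ramified and FILE 2 turns `ord_v̄(N_{F/K} b)` into `ord_{w′}(b)` exactly. On the `v`-LINE
`F = K^{(v)}_m` (κ₁ unramified outside `v`) the place `v̄` is UNRAMIFIED (`I_𝔓 ≤ ker κ₁ ≤ Gal(K̄/F)`) and, on the frame field `ℚ(√−7)`, UNDECOMPOSED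
(cf2c-w8 g4 `LinePin.not_decomp_vbar_le_layerSubgroup_one_of_isUnramifiedOutside`: `D_v̄ ⊄ κ₁⁻¹(2ℤ₂)`), so there is ONE place `w′ ∣ v̄` with
`e = 1`, `f = [F:K] = p^m`, and the norm trick gives only `ord_v̄(N_{F/K} b) = [F:K] · ord_{w′}(b)`:
* §1 `log_valuation_norm_eq_mul_log_valuation_of_isUnramifiedIn` — `F/K` Galois, `Algebra.IsUnramifiedIn (𝓞 F) v`, `w ∣ v` fixed by all of
  `Gal(F/K)`: `log v_v(N b) = [F:K] · log v_w(b)` (`IsUnramifiedIn.ramificationIdx_eq_one` + `valuation_liesOver` + `norm_eq_prod_automorphisms`);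
  `forall_smul_eq_of_absolute` (`Γ_K = D_𝔓 · Gal(K̄/F)` ⟹ every `g` fixes the place below `𝔓`, -w4 g14 `absRestrictNormalHom_smul_eq_of_smul_eq`),
  `isUnramifiedIn_of_forall_inertia_le` (`I_𝔓 ≤ Gal(K̄/F)` for all `𝔓 ∣ v` ⟹ unramified, tree `isUnramifiedIn_iff_forall_inertia_absRestrictNormalHom_eq_one`),
  `log_valuation_norm_eq_mul_log_valuation_of_unramified_undecomposed` (every `w′ : v̄.Extension (𝓞 F)`).
* §2 **`dvd_mul_log_valuation_of_dualShapiro_mem_of_unramified`** — LOSSY B5-U: 6b clause (iii) at `v̄` ⟹ `(n : ℤ) ∣ [F:K] · log v_{w′}(b)`; its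
  consumer is the lossy class-level (PRO-NULL)_U `KummerU.exists_level_resH1Hom_eq_zero_of_local_lossy` (p707927, `l := m` for `[F:K] = p^m`).
* §3 the `v`-LINE inputs in `Γ_K`-currency: `forall_inertia_le_galFixing_layer` (κ unramified outside `v ≠ v̄`), and
  **`forall_exists_decomp_mul_mem_galFixing_layer`** — `D_v̄ ⊄ κ⁻¹(pℤ_p)` ⟹ `Γ_K = D_𝔓 · Gal(K̄/K_m)` for every `𝔓 ∣ v̄`, every layer
  (`ℤ_p`-saturation `AnomalousLocalTorsion.exists_mem_apply_toAdd_eq_of_dvd`, `D_v̄ = D_{𝔓₀}`, conjugation to the other primes).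
presearch: folklore (Neukirch I (9.6), II (9.6); Washington §13.1); no new fact. beyond-print theorem: no.

References: [NeukirchANT1999] Ch. I §9 (9.1)–(9.6), Ch. II §9 (9.6); [Washington1997] §13.1; [SerreLocalFields1979] VII §7, XIV §1 Prop. 3;
[Agboola2007] §1 p. 1.
-/

noncomputable section

open scoped Classical Pointwise ContRepresentation

set_option linter.dupNamespace false
set_option autoImplicit false

open CategoryTheory NumberField IsDedekindDomain Field IntermediateField
open Literature.NumberTheory.EllipticCurves Literature.NumberTheory.EllipticCurves.GreenbergSelmer
open Literature.NumberTheory.GaloisRepresentations Literature.NumberTheory.GaloisRepresentations.LocalWeilDatum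
open Literature.NumberTheory.GaloisRepresentations.DiscreteGaloisModule (SelmerStructure mu MuCarrier TateDual tateDual
  coindTateDualMor coindTateDualHom unramifiedSubgroup localMap)
open Literature.NumberTheory.GaloisCohomology
open Summit.BirchSwinnertonDyer.Rank1Residual.X11b.LocBridge

namespace Summit.BirchSwinnertonDyer.BirchSwinnertonDyer.Theorems.PrintCf2.NormAtVbar

/-! ## §1. An unramified, undecomposed place of a Galois layer: `ord_v(N_{F/K} b) = [F:K] · ord_w(b)` -/

section Unramified

variable {K : Type} [Field K] [NumberField K] (F : IntermediateField K (AlgebraicClosure K)) [FiniteDimensional K F] [IsGalois K F]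
  [NumberField F]

/-- **`e = 1` and ONE place above `v` ⟹ `log v_v(N_{F/K} b) = [F:K] · log v_w(b)`.** For a finite Galois extension `F/K` of number fields
UNRAMIFIED at `v` (`Algebra.IsUnramifiedIn`) and a place `w ∣ v` fixed by ALL of `Gal(F/K)` (`w` is the only place above `v`, `f(w∣v) = [F:K]`):
`v_v(x) = v_w(x)` for `x ∈ K` (`valuation_liesOver` with `e = 1`, `IsUnramifiedIn.ramificationIdx_eq_one`) and `v_w(N b) = v_w(b)^{[F:K]}`
(`N b = ∏_σ σ b`, every `σ` fixing `w`). [cite: NeukirchANT1999, Ch. I §9 (9.6), Ch. II §9] -/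
theorem log_valuation_norm_eq_mul_log_valuation_of_isUnramifiedIn (v : HeightOneSpectrum (𝓞 K)) (w : HeightOneSpectrum (𝓞 F))
    [w.asIdeal.LiesOver v.asIdeal] (hunr : Algebra.IsUnramifiedIn (𝓞 F) v.asIdeal) (hfix : ∀ g : F ≃ₐ[K] F, g • w = w) (b : F) :
    WithZero.log (v.valuation K (Algebra.norm K b)) = (Module.finrank K F : ℤ) * WithZero.log (w.valuation F b) := by
  haveI : Module.Finite (𝓞 K) (𝓞 F) := IsIntegralClosure.finite (𝓞 K) K F (𝓞 F)
  haveI := v.isPrime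
  haveI := w.isPrime
  have he : v.asIdeal.ramificationIdx' w.asIdeal = 1 := by
    rw [Ideal.ramificationIdx'_eq_ramificationIdx v.asIdeal w.asIdeal v.ne_bot]
    exact hunr.ramificationIdx_eq_one inferInstance
  have hval := HeightOneSpectrum.valuation_liesOver F v w (Algebra.norm K b)
  have hσ : ∀ σ : F ≃ₐ[K] F, w.valuation F (σ b) = w.valuation F b := fun σ ↦ by
    have h := Literature.NumberTheory.Automorphic.HeightOneSpectrum.valuation_algEquiv_smul K σ w b
    rwa [hfix] at h
  rw [he, pow_one, Algebra.norm_eq_prod_automorphisms K b, map_prod, Finset.prod_congr rfl fun σ _ ↦ hσ σ, Finset.prod_const,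
    Finset.card_univ, ← Nat.card_eq_fintype_card] at hval
  rw [hval, WithZero.log_pow, nsmul_eq_mul]
  congr 1
  exact_mod_cast IsGalois.card_aut_eq_finrank K F

omit [FiniteDimensional K F] [NumberField K] [NumberField F] in
/-- **`Γ_K = D_𝔓 · Gal(K̄/F)` ⟹ every `g ∈ Gal(F/K)` fixes the place `w` of `F` below `𝔓`** (restriction `Γ_K ↠ Gal(F/K)` kills `Gal(K̄/F)`;
an element stabilising `𝔓 ∣ w` fixes `w`, -w4 g14 `KummerUDict.absRestrictNormalHom_smul_eq_of_smul_eq`). [cite: NeukirchANT1999, Ch. I §9 (9.1)–(9.4)] -/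
theorem forall_smul_eq_of_absolute (w : HeightOneSpectrum (𝓞 F)) (𝔓 : Ideal (absIntegers (𝓞 K) K))
    (h𝔓 : 𝔓.comap (ringOfIntegersToIntegralClosure (k := K) (Ω := AlgebraicClosure K) F) = w.asIdeal)
    (hdec : ∀ σ : absoluteGaloisGroup K, ∃ τ : absoluteGaloisGroup K, τ • 𝔓 = 𝔓 ∧ τ⁻¹ * σ ∈ galFixing K F) :
    ∀ g : F ≃ₐ[K] F, g • w = w := by
  intro g
  obtain ⟨σ, hσ⟩ := AlgEquiv.restrictNormalHom_surjective (AlgebraicClosure K) g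
  let σ' : absoluteGaloisGroup K := σ
  obtain ⟨τ, hτ, hτσ⟩ := hdec σ'
  have hker : absRestrictNormalHom F (τ⁻¹ * σ') = 1 :=
    (MonoidHom.mem_ker (f := AlgEquiv.restrictNormalHom F)).mp
      ((SetLike.ext_iff.mp (IntermediateField.restrictNormalHom_ker F) (τ⁻¹ * σ')).mpr hτσ)
  have hg : g = absRestrictNormalHom F τ := by
    rw [map_mul, map_inv, inv_mul_eq_one] at hker
    rw [hker]
    exact hσ.symm
  rw [hg]
  exact KummerUDict.absRestrictNormalHom_smul_eq_of_smul_eq F w 𝔓 h𝔓 hτ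

omit [NumberField F] in
/-- **All inertia groups above `v` inside `Gal(K̄/F)` ⟹ `F/K` is unramified at `v`** (`Algebra.IsUnramifiedIn (𝓞 F) v`), by the tree's
criterion `isUnramifiedIn_iff_forall_inertia_absRestrictNormalHom_eq_one`. [cite: NeukirchANT1999, Ch. I §9 (9.6)] -/
theorem isUnramifiedIn_of_forall_inertia_le (v : HeightOneSpectrum (𝓞 K))
    (hI : ∀ 𝔓 ∈ v.primesAbove, 𝔓.inertia (absoluteGaloisGroup K) ≤ galFixing K F) :
    Algebra.IsUnramifiedIn (𝓞 F) v.asIdeal := by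
  refine (Literature.NumberTheory.NumberFields.isUnramifiedIn_iff_forall_inertia_absRestrictNormalHom_eq_one F v).2
    fun 𝔓 h𝔓 g hg ↦ ?_
  exact (MonoidHom.mem_ker (f := AlgEquiv.restrictNormalHom F)).mp
    ((SetLike.ext_iff.mp (IntermediateField.restrictNormalHom_ker F) g).mpr (hI 𝔓 h𝔓 hg))

/-- **UNRAMIFIED + UNDECOMPOSED at `v̄`, `Γ_K`-currency ⟹ `log v_v̄(N_{F/K} b) = [F:K] · log v_{w′}(b)` at every place `w′ ∣ v̄` of `F`.**
Hypotheses: every inertia group `I_𝔓`, `𝔓 ∣ v̄`, lies in `Gal(K̄/F)` (unramified), and `Γ_K = D_𝔓 · Gal(K̄/F)` for every `𝔓 ∣ v̄`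
(undecomposed) — on the `v`-LINE of the frame both hold at `v̄` (§3). [cite: NeukirchANT1999, Ch. I §9 (9.6)] -/
theorem log_valuation_norm_eq_mul_log_valuation_of_unramified_undecomposed (vbar : HeightOneSpectrum (𝓞 K))
    (hI : ∀ 𝔓 ∈ vbar.primesAbove, 𝔓.inertia (absoluteGaloisGroup K) ≤ galFixing K F)
    (hD : ∀ 𝔓 ∈ vbar.primesAbove, ∀ σ : absoluteGaloisGroup K,
      ∃ τ : absoluteGaloisGroup K, τ • 𝔓 = 𝔓 ∧ τ⁻¹ * σ ∈ galFixing K F)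
    (w' : vbar.Extension (𝓞 F)) (b : F) :
    WithZero.log (vbar.valuation K (Algebra.norm K b)) = (Module.finrank K F : ℤ) * WithZero.log (w'.1.valuation F b) := by
  obtain ⟨𝔓, h𝔓prime, h𝔓⟩ := KummerU.exists_prime_absIntegers_comap_eq F w'.1
  haveI := h𝔓prime
  have hunder : w'.1.asIdeal.under (𝓞 K) = vbar.asIdeal := congrArg HeightOneSpectrum.asIdeal w'.2
  haveI : w'.1.asIdeal.LiesOver vbar.asIdeal := ⟨hunder.symm⟩
  have h𝔓v : 𝔓 ∈ vbar.primesAbove := by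
    refine HeightOneSpectrum.mem_primesAbove_iff.2 ⟨h𝔓prime, ⟨?_⟩⟩
    rw [Ideal.under_def, KummerU.comap_algebraMap_eq_under_of_comap_eq F h𝔓, hunder]
  exact log_valuation_norm_eq_mul_log_valuation_of_isUnramifiedIn F vbar w'.1 (isUnramifiedIn_of_forall_inertia_le F vbar hI)
    (forall_smul_eq_of_absolute F w'.1 𝔓 h𝔓 (hD 𝔓 h𝔓v)) b

end Unramified

/-! ## §2. B5-U, LOSSY FORM (for layers where `v̄` is unramified and undecomposed): `n ∣ [F:K] · ord_{w′}(b)` -/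

section B5ULossy

variable {K : Type} [Field K] [NumberField K]
  {M : Type} [AddCommGroup M] [TopologicalSpace M] [DiscreteTopology M] [Finite M] (ρ : DiscreteGaloisModule K M)
  {M' : Type} [AddCommGroup M'] [DistribMulAction (absoluteGaloisGroup K) M'] [TopologicalSpace M'] [DiscreteTopology M']
  (hM' : ∀ m : M', IsOpen {σ : absoluteGaloisGroup K | σ • m = m})
  {n : ℕ} [NeZero n] (B : M →+ M' →+ MuCarrier K n)
  (hB : ∀ (σ : absoluteGaloisGroup K) (m : M) (m' : M'), B (ρ σ m) (ofSMul M' hM' σ m') = mu K n σ (B m m'))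
  (F : IntermediateField K (AlgebraicClosure K)) [FiniteDimensional K F] [IsGalois K F] [NumberField F]
  (hU : IsOpen (galFixing K F : Set (absoluteGaloisGroup K)))
  [Fintype (absoluteGaloisGroup K ⧸ galFixing K F)]
  {m₀ : M} (hm₀ : ∀ σ : absoluteGaloisGroup K, ρ σ m₀ = m₀) (hn0 : n • m₀ = 0)
  (ι' : M' →+ Additive (AlgebraicClosure K)ˣ) (hι'B : ∀ m' : M', Additive.toMul (ι' m') = muVal K n (B m₀ m'))

include hm₀ hn0 hι'B in
/-- **B5-U, LOSSY FORM.** Setting of `dvd_log_valuation_of_dualShapiro_mem_of_totallyRamified` (FILE 2) except that `v̄` is now UNRAMIFIED and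
UNDECOMPOSED in `F` (`hI`, `hD`) instead of totally ramified: the `v̄`-clause of the dual-Shapiro class (6b clause (iii), VERBATIM) gives
`(n : ℤ) ∣ [F:K] · log v_{w′}(b)` at every `w′ ∣ v̄` — for `n = p^M`, `[F:K] = p^m` this is `p^{M−m} ∣ ord_{w′}(b)`, absorbed by the level shift of
the lossy class-level (PRO-NULL)_U. (FILE 1 `dvd_log_valuation_norm_of_dualShapiro_mem` + §1.) [cite: SerreLocalFields1979, XIV §1 Prop. 3, VII §7]
[cite: NeukirchANT1999, Ch. I §9 (9.6)] -/
theorem dvd_mul_log_valuation_of_dualShapiro_mem_of_unramified (vbar : HeightOneSpectrum (𝓞 K))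
    (hI : ∀ 𝔓 ∈ vbar.primesAbove, 𝔓.inertia (absoluteGaloisGroup K) ≤ galFixing K F)
    (hD : ∀ 𝔓 ∈ vbar.primesAbove, ∀ σ : absoluteGaloisGroup K,
      ∃ τ : absoluteGaloisGroup K, τ • 𝔓 = 𝔓 ∧ τ⁻¹ * σ ∈ galFixing K F)
    {s : absoluteGaloisGroup K ⧸ galFixing K F → absoluteGaloisGroup K}
    (hs : ∀ y, (s y : absoluteGaloisGroup K ⧸ galFixing K F) = y) (hs1 : s ((1 : absoluteGaloisGroup K) : absoluteGaloisGroup K ⧸ galFixing K F) = 1)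
    (φ : contOneCocycles (discreteTopRep (galFixing K F) M'))
    (hvbar : galoisCohomology.localization ((ρ.coind (galFixing K F) hU).tateDual n) (Sum.inr vbar) 1
        (cohomologyMap (coindTateDualMor ρ (ofSMul M' hM') (galFixing K F) B hU hB) 1
          (shapiroLift (ofSMul M' hM').toTopRep (galFixing K F) hU hs hs1 (oneCocycleClass _ φ))) ∈
      (LocalInvariants.canonical K n).dualLocalCondition (ρ.coind (galFixing K F) hU) (Sum.inr vbar)
        (unramifiedSubgroup (GaloisRep.toLocal vbar (ρ.coind (galFixing K F) hU)) 1))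
    (β : (AlgebraicClosure K)ˣ) (hβ : ∀ u : galFixing K F, Additive.toMul (ι' (φ.1 u)) = (u : absoluteGaloisGroup K) • β / β)
    (b : F) (hb : ((b : F) : AlgebraicClosure K) = ((β ^ n : (AlgebraicClosure K)ˣ) : AlgebraicClosure K))
    (w' : vbar.Extension (𝓞 F)) : (n : ℤ) ∣ (Module.finrank K F : ℤ) * WithZero.log (w'.1.valuation F b) := by
  rw [← log_valuation_norm_eq_mul_log_valuation_of_unramified_undecomposed F vbar hI hD w' b]
  exact dvd_log_valuation_norm_of_dualShapiro_mem ρ hM' B hB F hU hs hs1 hm₀ hn0 vbar φ hvbar β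
    (fun u ↦ by rw [← hι'B]; exact hβ u) b hb

end B5ULossy

/-! ## §3. On the `v`-LINE: `v̄` is unramified (`κ₁` unramified outside `v`) and undecomposed (`¬ D_v̄ ≤ κ₁⁻¹(pℤ_p)`) in every layer -/

section VLine

variable {K : Type} [Field K] [NumberField K] {p : ℕ} [Fact p.Prime]

/-- **Every inertia group above `v̄` lies in every layer subgroup of a `ℤ_p`-extension unramified outside `v ≠ v̄`** (`I_𝔓 ≤ ker κ₁ ≤ Gal(K̄/K^{(v)}_m)`,
-w2 g13 `SplitPrimeLine.inertia_le_kerSubgroup_of_isUnramifiedOutside`, `galFixing_layer`). [cite: Agboola2007, §1 p. 1] -/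
theorem forall_inertia_le_galFixing_layer {κ : ZpExtension K p} {v vbar : HeightOneSpectrum (𝓞 K)} (hκ : κ.IsUnramifiedOutside v)
    (hne : vbar ≠ v) (m : ℕ) :
    ∀ 𝔓 ∈ vbar.primesAbove, 𝔓.inertia (absoluteGaloisGroup K) ≤ galFixing K (κ.layer m) := fun 𝔓 h𝔓 ↦ by
  rw [Literature.NumberTheory.GaloisCohomology.galFixing_layer K κ m]
  exact (SplitPrimeLine.inertia_le_kerSubgroup_of_isUnramifiedOutside hκ hne h𝔓).trans (κ.kerSubgroup_le_layerSubgroup m)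

/-- **UNDECOMPOSED, `Γ_K`-currency: if `D_v̄ ⊄ κ⁻¹(pℤ_p)` then `Γ_K = D_𝔓 · Gal(K̄/K_m)` for every prime `𝔓 ∣ v̄` and every layer.**
`κ(D_v̄)` is a closed `ℤ_p`-submodule containing a unit, hence all of `κ(Γ_K)` (`AnomalousLocalTorsion.exists_mem_apply_toAdd_eq_of_dvd`); so
`σ = τ · (τ⁻¹σ)` with `τ ∈ D_v̄ = D_{𝔓₀}` (`decompositionSubgroup_adicCompletionPrime_eq_range`), `κ τ = κ σ`; the other primes `𝔓 = g • 𝔓₀` have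
`D_𝔓 = g D_{𝔓₀} g⁻¹` and the layer subgroup is normal. (On the frame field `ℚ(√−7)` the input holds for every `κ₁` unramified outside `v`:
cf2c-w8 g4 `LinePin.not_decomp_vbar_le_layerSubgroup_one_of_isUnramifiedOutside`.) [cite: Washington1997, §13.1] [cite: NeukirchANT1999, Ch. II §9 (9.6)] -/
theorem forall_exists_decomp_mul_mem_galFixing_layer (κ : ZpExtension K p) {vbar : HeightOneSpectrum (𝓞 K)}
    (hund : ¬ GreenbergSelmer.decomp vbar ≤ κ.layerSubgroup 1) (m : ℕ) :
    ∀ 𝔓 ∈ vbar.primesAbove, ∀ σ : absoluteGaloisGroup K,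
      ∃ τ : absoluteGaloisGroup K, τ • 𝔓 = 𝔓 ∧ τ⁻¹ * σ ∈ galFixing K (κ.layer m) := by
  -- a decomposition element of unit `κ`-value
  obtain ⟨τ₁, hτ₁, hnot⟩ := SetLike.not_le_iff_exists.mp hund
  rw [ZpExtension.mem_layerSubgroup, pow_one] at hnot
  have hne : κ τ₁ ≠ 1 := by
    intro h
    apply hnot
    rw [h]
    exact ⟨0, by rw [mul_zero]; rfl⟩
  have hval : ((κ τ₁).toAdd).valuation = 0 := by
    by_contra hv
    apply hnot
    have hb0 : (κ τ₁).toAdd ≠ 0 := fun h0 ↦ hne (by rw [← ofAdd_toAdd (κ τ₁), h0]; rfl)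
    rw [PadicInt.unitCoeff_spec hb0]
    exact dvd_mul_of_dvd_right (dvd_pow_self _ hv) _
  have hclosed : IsClosed (GreenbergSelmer.decomp vbar : Set (absoluteGaloisGroup K)) :=
    Summit.BirchSwinnertonDyer.Rank1Residual.X11b.Coinv.isClosed_decomp vbar
  -- every `κ`-value is taken on `D_v̄`
  have hsat : ∀ σ : absoluteGaloisGroup K, ∃ τ ∈ GreenbergSelmer.decomp vbar, κ τ = κ σ := fun σ ↦ by
    obtain ⟨τ, hτ, hτv⟩ := AnomalousLocalTorsion.exists_mem_apply_toAdd_eq_of_dvd κ (GreenbergSelmer.decomp vbar) hclosed hτ₁ hne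
      (x := (κ σ).toAdd) (by rw [hval, pow_zero]; exact one_dvd _)
    exact ⟨τ, hτ, by rw [← ofAdd_toAdd (κ τ), hτv, ofAdd_toAdd]⟩
  -- `D_v̄ = D_{𝔓₀}`; transport to every prime above `v̄`
  intro 𝔓 h𝔓 σ
  obtain ⟨g, hg⟩ := HeightOneSpectrum.exists_smul_eq_of_mem_primesAbove_holds (K := K) (v := vbar)
    (adicCompletionPrime_mem_primesAbove K vbar) h𝔓
  obtain ⟨τ, hτ, hκτ⟩ := hsat (g⁻¹ * σ * g)
  have hτD : τ ∈ (adicCompletionPrime K vbar).decompositionSubgroup (absoluteGaloisGroup K) := by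
    rw [decompositionSubgroup_adicCompletionPrime_eq_range]
    exact hτ
  refine ⟨g * τ * g⁻¹, ?_, ?_⟩
  · -- `g τ g⁻¹` stabilises `g • 𝔓₀`
    have hmem : g * τ * g⁻¹ ∈ (g • adicCompletionPrime K vbar).decompositionSubgroup (absoluteGaloisGroup K) := by
      rw [Ideal.decompositionSubgroup_smul]
      exact ⟨τ, hτD, rfl⟩
    rw [← hg]
    exact Ideal.mem_decompositionSubgroup_iff.mp hmem
  · rw [Literature.NumberTheory.GaloisCohomology.galFixing_layer K κ m]
    refine κ.kerSubgroup_le_layerSubgroup m (ZpExtension.mem_kerSubgroup.2 ?_)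
    have h1 : (g * τ * g⁻¹)⁻¹ * σ = g * (τ⁻¹ * (g⁻¹ * σ * g)) * g⁻¹ := by group
    rw [h1, map_mul, map_mul, map_mul, map_inv, hκτ, inv_mul_cancel, mul_one, map_inv, mul_inv_cancel]

end VLine

end Summit.BirchSwinnertonDyer.BirchSwinnertonDyer.Theorems.PrintCf2.NormAtVbar

end
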